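import Mathlib
import HarnessLib
import Summits.ValiantsHypothesis.ValiantsHypothesis.Theses.MonotoneRestoration
import Literature.Computability.AlgebraicComplexity.ArithCircuit
import Literature.Computability.AlgebraicComplexity.ArithCircuitProofs
import Literature.Computability.AlgebraicComplexity.MonotoneStructure
import Literature.Computability.AlgebraicComplexity.PermanentIrreducible
import Literature.ModelTheory.FiniteModelTheory.CkEquiv
import Summits.ValiantsHypothesis.ValiantsHypothesis.Theorems.MonotoneRestorationMonotoneRestorationQPCosetCount
import Summits.ValiantsHypothesis.ValiantsHypothesis.Theorems.MonotoneRestorationMonotoneRestorationQPSymmetricLB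
import Summits.ValiantsHypothesis.ValiantsHypothesis.Theorems.MonotoneRestorationMonotoneRestorationQPSupportSymmetrisation
import Summits.ValiantsHypothesis.ValiantsHypothesis.Theorems.MonotoneRestorationMonotoneRestorationQPSparseRegime
import Summits.ValiantsHypothesis.ValiantsHypothesis.Theorems.MonotoneRestorationMonotoneRestorationQPBeta
import Literature.Computability.AlgebraicComplexity.SymmetricArithCircuit
import Literature.Computability.AlgebraicComplexity.DawarWilsenach2025Proofs
import Literature.GroupTheory.PermutationGroups.SmallIndexSubgroups
import Summits.ValiantsHypothesis.ValiantsHypothesis.Theorems.MonotoneRestorationQP.Negative.LoadBearing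
import Summits.ValiantsHypothesis.ValiantsHypothesis.Theorems.MonotoneRestorationMonotoneRestorationQPPermSupportCount

/-! TTRL-lite variant V19307 of stmt-ValiantsHypothesis-15886

Variant `lemma_proposal` [T] of `stub_gammaArithmetic` (line c2 of crux `MonotoneRestorationQP`):
the TRANSFER step from the `m`-world (bounds stated for all `m ≥ M`) to the `n`-world (bounds
stated for all `n ≥ 2 ^ M`) through `m := Nat.log 2 n`. If `f m ≤ 2 ^ m` eventually in `m`, then
`f (Nat.log 2 n) ≤ n` eventually in `n`, with the explicit threshold `N := 2 ^ M`: from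
`2 ^ M ≤ n` we get `M ≤ Nat.log 2 n` (`Nat.le_log_of_pow_le`) and
`2 ^ Nat.log 2 n ≤ n` (`Nat.pow_log_le_self`, as `n ≠ 0`).
-/

-- `Summit.ValiantsHypothesis.ValiantsHypothesis.…` is the tree's mandated single-conjunct layout
-- (Sub = Summit), so the duplicated namespace component is intended.
set_option linter.dupNamespace false

namespace Summit.ValiantsHypothesis.ValiantsHypothesis.Theorems

open Summit.ValiantsHypothesis.ValiantsHypothesis.Theses.MonotoneRestoration
open Literature.Computability.AlgebraicComplexity

/-- **TTRL-lite variant V19307 of `stub_gammaArithmetic`** (transfer `m`-world → `n`-world).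
If `f m ≤ 2 ^ m` for every `m ≥ M`, then `f (Nat.log 2 n) ≤ n` for every `n ≥ 2 ^ M`:
`2 ^ M ≤ n` forces `M ≤ Nat.log 2 n`, and `2 ^ Nat.log 2 n ≤ n` since `n ≠ 0`. -/
theorem stub_gammaArithmetic_var19307 :
    ∀ (f : ℕ → ℕ) (M : ℕ), (∀ m : ℕ, M ≤ m → f m ≤ 2 ^ m) →
      ∀ n : ℕ, 2 ^ M ≤ n → f (Nat.log 2 n) ≤ n := by
  intro f M hf n hn
  have hn0 : n ≠ 0 := (lt_of_lt_of_le (Nat.two_pow_pos M) hn).ne'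
  have hM : M ≤ Nat.log 2 n := Nat.le_log_of_pow_le (by norm_num) hn
  exact (hf _ hM).trans (Nat.pow_log_le_self 2 hn0)

end Summit.ValiantsHypothesis.ValiantsHypothesis.Theorems
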